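import Literature.NumberTheory.EllipticCurves.LocalTorsionMultiplicativeProofs
import Literature.NumberTheory.EllipticCurves.AnomalousOfRationalTorsionProofs
import Literature.NumberTheory.EllipticCurves.KuriharaNumberKimShaLengthLocalTorsionTrivial
import Literature.NumberTheory.EllipticCurves.Kim2026.ShaLengthRankZeroLowerBound
import HarnessLib

/-!
# `E(ℚ_p)[p] = 0` at a good prime `p ≥ 3` that is not anomalous (`p ∤ #Ẽ(𝔽_p)`, i.e. `a_p ≢ 1 (mod p)`)
# (Silverman, *AEC* VII.2.1, VII.3.1 with IV.6.1) — and the `(t0)` binder of Kim's twins discharged there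

Sources: J. H. Silverman, *The Arithmetic of Elliptic Curves*, 2nd ed., GTM 106 (2009)
[SilvermanAEC2009]: Prop. VII.2.1 (reduction `E(ℚ_p) → Ẽ(𝔽_p)` is a homomorphism with kernel
`E₁(ℚ_p)` at a good prime), Prop. VII.3.1 with Thm. IV.6.1 (`E₁(ℚ_p)` has no `p`-torsion for `p ≥ 3`);
C.-H. Kim, Amer. J. Math. 148 (2026) = arXiv:2203.12159 [Kim2022StructureSelmer], §3.1.1 (PDF p. 15):
"Thus, if `E` has non-anomalous good reduction at `p`, then `E(ℚ_p)[p]` is trivial" (anomalous: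
`p ∣ #Ẽ(𝔽_p) = N_p = p + 1 − a_p`, i.e. `a_p ≡ 1 (mod p)`; Mazur, Invent. Math. 18 (1972) §1), summed
up in Prop. 3.2 there (= journal Prop. 3.1: the exact locus `E(ℚ_p)[p] ≠ 0`).

`Proofs`-style file (THEOREMS ONLY: no definition, no named fact, no instance; D-0026 net debt 0): the
good-reduction companion of `LocalTorsionMultiplicativeProofs`, and a Literature-side home of a lemma the
`Summits/` tree proves twice for its own kernels (`…Rank1Residual.Partition.LocalTorsion.
localTorsion_eq_zero_of_good_of_not_dvd`, `…Rank1Residual.Ordinary.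
forall_nsmul_eq_zero_padic_of_not_dvd_reductionPointCount`; not importable under `Literature/`). Proof:

> `N_p • P ∈ E₁(ℚ_p)` (`WeierstrassCurve.isInReductionKernel_reductionPointCount_nsmul`, AEC VII.2.1);
> `p • (N_p • P) = N_p • (p • P) = O`, so `N_p • P = O` because `E₁(ℚ_p)[p] = 0` for `p ≥ 3`
> (`LocalTorsionMult.eq_zero_of_isInReductionKernel_of_prime_nsmul`, AEC VII.3.1/IV.6.1);
> `P` is killed by `p` and by `N_p` with `gcd(p, N_p) = 1`, hence `P = O`.

## Statements (`W/ℚ` globally minimal elliptic, `p ≥ 3` prime)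

* §1 `localTorsion_eq_zero_of_good` — `p ∤ Δ_min(W)`, `p ∤ N_p` ⟹ every `P ∈ E(ℚ_p)` with
  `p • P = O` is `O`; `…_int` (`ℤ`-scalar spelling); `…_of_not_dvd_frobeniusTrace_sub_one` (hypotheses
  `W.HasGoodReductionAtPrime p`, `¬ p ∣ a_p − 1`); `…_of_frobeniusTrace_ne_one` (`p > 5`, `a_p ≠ 1`:
  by Hasse `a_p ≡ 1 (mod p) ⟺ a_p = 1` there, `CoatesWiles1977.not_dvd_reductionPointCount_of_frobeniusTrace_ne_one`).
* §2 the same in the `(t0)`-binder currency `Nat.card {Q ∈ E(ℚ_p) | p • Q = 0} = 1` of the tree's Kim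
  twins (`natCard_localPTorsion_eq_one_iff`): `natCard_localPTorsion_eq_one_of_good`,
  `…_of_good_of_not_dvd_frobeniusTrace_sub_one`, `…_of_good_of_frobeniusTrace_ne_one`, and the
  multiplicative wrapper `natCard_localPTorsion_eq_one_of_mult` (non-split, or `p ∤ v_p(Δ_min)`).
* §3 CONSUMERS — the five PROOF-COVERED `(t0)`-TWINS of C.-H. Kim's structure-theorem facts landed by
  ARM P (cell `bsd-cited`, D-audit sheet D-AUDIT-r10 cfa522325b7b7321 §D.2 with ADDENDUM-1
  463fcb17390e3a71; flag `K26-(6)-shallow@t>0` on the literal facts) READ AT A GOOD NON-ANOMALOUS `p`: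
  for each twin `T` a proved theorem `T → (T with the (t0) binder replaced by good reduction at p and
  ¬ p ∣ a_p − 1)` — B5 `Kim2022_rankZero_padicValRat_sha_of_kuriharaNumber_ne_zero_of_nonAnomalous`,
  B6 `Kim2022_rankOne_card_sha_eq_one_of_kuriharaNumber_ne_zero_of_nonAnomalous`,
  B7 `Kim2022_rankZero_padicValRat_sha_of_kuriharaNumber_ne_zero_of_maninConstant_of_nonAnomalous`,
  B8 `Kim2022_rankOne_card_sha_eq_one_of_kuriharaNumber_ne_zero_of_maninConstant_of_nonAnomalous`,
  B12 `Kim2026.rankZero_le_padicValNat_sha_of_kuriharaNumber_ne_zero_of_nonAnomalous` — and, for the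
  two twins whose prime may be multiplicative (B5, B6), the automatic multiplicative locus
  `…_of_mult_auto` (non-split, or `p ∤ v_p(Δ_min)`). So wherever `p` is good with `a_p ≢ 1 (mod p)`
  the proof-covered twin costs exactly the literal fact's binders plus the class datum `a_p`; the rows
  that still need a local `p`-torsion decider are the anomalous good `p` (and split multiplicative
  `p ∣ v_p(Δ_min)`), as printed (Kim, Prop. 3.2). Nothing is booked here (ARM P moves 0 classes by
  design); no `Summits/` file is touched.

## References
* J. H. Silverman, *The Arithmetic of Elliptic Curves*, 2nd ed., GTM 106 (2009), Prop. VII.2.1,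
  Prop. VII.3.1, Thm. IV.6.1, Thm. V.1.1 (Hasse). [SilvermanAEC2009]
* C.-H. Kim, *The structure of Selmer groups and the Iwasawa main conjecture for elliptic curves*,
  Amer. J. Math. 148 (2026) = arXiv:2203.12159, §3.1.1 and Prop. 3.2 (PDF p. 15). [Kim2022StructureSelmer]
* B. Mazur, Invent. Math. 18 (1972) 183–266, §1 (anomalous primes). [Mazur1972]
-/

noncomputable section

open scoped Classical

open WeierstrassCurve CongruenceSubgroup Literature.NumberTheory.EllipticCurves.ModularForms

namespace Literature.NumberTheory.EllipticCurves

section LocalTorsionGood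

variable (W : WeierstrassCurve ℚ) [W.IsElliptic] [W.IsGloballyMinimal] (p : ℕ) [hp : Fact p.Prime]

omit hp W in
/-- In an additive group, an element killed by a prime `p` and by a natural number `n` with `p ∤ n`
is zero (`addOrderOf x ∣ gcd(p, n) = 1`). [folklore] -/
private theorem eq_zero_of_prime_nsmul_of_nsmul' {A : Type*} [AddGroup A] (hp : p.Prime) {n : ℕ}
    (hn : ¬ p ∣ n) (x : A) (hpx : p • x = 0) (hnx : n • x = 0) : x = 0 := by
  have h1 : addOrderOf x ∣ p := addOrderOf_dvd_iff_nsmul_eq_zero.mpr hpx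
  have h2 : addOrderOf x ∣ n := addOrderOf_dvd_iff_nsmul_eq_zero.mpr hnx
  have hgcd : Nat.gcd p n = 1 := (hp.coprime_iff_not_dvd.mpr hn).gcd_eq_one
  have h3 : addOrderOf x ∣ 1 := hgcd ▸ Nat.dvd_gcd h1 h2
  exact AddMonoid.addOrderOf_eq_one_iff.mp (Nat.dvd_one.mp h3)

/-! ### §1 `E(ℚ_p)[p] = 0` at a good non-anomalous `p ≥ 3` -/

/-- **`E(ℚ_p)[p] = 0` at a good prime `p ≥ 3` with `p ∤ #Ẽ(𝔽_p)`.** For `W/ℚ` elliptic and globally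
minimal, a prime `p ≥ 3` with `p ∤ Δ_min(W)` (good reduction) and `p ∤ N_p`
(`N_p = W.reductionPointCount p = #Ẽ(𝔽_p)`; i.e. `a_p ≢ 1 (mod p)`, `p` not anomalous): every
`P ∈ W(ℚ_p)` with `p • P = O` is `O`. Proof: `N_p • P ∈ E₁(ℚ_p)` (AEC VII.2.1, tree
`isInReductionKernel_reductionPointCount_nsmul`) is killed by `p`, so it is `O` since `E₁(ℚ_p)[p] = 0`
for `p ≥ 3` (AEC VII.3.1 with IV.6.1, tree `eq_zero_of_isInReductionKernel_of_prime_nsmul`); and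
`gcd(p, N_p) = 1`. (Summits-side twins, not importable here:
`Rank1Residual.Partition.LocalTorsion.localTorsion_eq_zero_of_good_of_not_dvd`,
`Rank1Residual.Ordinary.forall_nsmul_eq_zero_padic_of_not_dvd_reductionPointCount`.)
[cite: SilvermanAEC2009, VII.2 Prop. 2.1 and VII.3 Prop. 3.1 (with IV.6 Thm. 6.1)] -/
theorem localTorsion_eq_zero_of_good (hp3 : 3 ≤ p) (hΔ : ¬ (p : ℤ) ∣ W.minimalDiscriminantInt)
    (hN : ¬ p ∣ W.reductionPointCount p)
    (P : (W.baseChange ℚ_[p]).toAffine.Point) (hP : p • P = 0) : P = 0 := by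
  haveI : (W.baseChange ℚ_[p]).IsElliptic := by rw [baseChange]; infer_instance
  -- `N_p • P ∈ E₁(ℚ_p)` and `p` kills it
  have hker : (W.baseChange ℚ_[p]).IsInReductionKernel (W.reductionPointCount p • P) :=
    W.isInReductionKernel_reductionPointCount_nsmul p hΔ P
  have hkill : p • (W.reductionPointCount p • P) = 0 := by
    rw [smul_comm, hP, nsmul_zero]
  have hzero : W.reductionPointCount p • P = 0 :=
    LocalTorsionMult.eq_zero_of_isInReductionKernel_of_prime_nsmul p hp3
      ((integralModelInt W).map (Int.castRingHom ℤ_[p])) (W.baseChange ℚ_[p])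
      (padicModel_baseChange W p) _ hker hkill
  exact eq_zero_of_prime_nsmul_of_nsmul' p hp.out hN P hP hzero

/-- The same with the `ℤ`-scalar spelling `(p : ℤ) • P = 0` (the spelling of the binder
`∀ P, (p : ℤ) • P = 0 → P = 0` of `Kim2022_kuriharaNumber_certificate` and of
`natCard_localPTorsion_eq_one_iff`).
[cite: SilvermanAEC2009, VII.3 Prop. 3.1 (with IV.6 Thm. 6.1)] -/
theorem localTorsion_eq_zero_of_good_int (hp3 : 3 ≤ p) (hΔ : ¬ (p : ℤ) ∣ W.minimalDiscriminantInt)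
    (hN : ¬ p ∣ W.reductionPointCount p)
    (P : (W.baseChange ℚ_[p]).toAffine.Point) (hP : (p : ℤ) • P = 0) : P = 0 :=
  localTorsion_eq_zero_of_good W p hp3 hΔ hN P (by rw [← natCast_zsmul]; exact hP)

/-- **`E(ℚ_p)[p] = 0` at a good `p ≥ 3` with `a_p ≢ 1 (mod p)`**, hypotheses in the currency of the
tree's class theorems: `W.HasGoodReductionAtPrime p` (⟹ `p ∤ Δ_min`, tree
`not_dvd_minimalDiscriminantInt_of_hasGoodReductionAtPrime'`, AEC VII.5.1(a)) and `¬ p ∣ a_p − 1`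
(⟺ `p ∤ N_p`, `a_p = p + 1 − N_p`, tree `dvd_reductionPointCount_iff_dvd_frobeniusTrace_sub_one`).
This is Kim's §3.1.1: "if `E` has non-anomalous good reduction at `p`, then `E(ℚ_p)[p]` is trivial".
[cite: SilvermanAEC2009, VII.2 Prop. 2.1, VII.3 Prop. 3.1, VII.5 Prop. 5.1(a)]
[cite: Kim2022StructureSelmer, §3.1.1 and Prop. 3.2 (PDF p. 15)] -/
theorem localTorsion_eq_zero_of_good_of_not_dvd_frobeniusTrace_sub_one (hp3 : 3 ≤ p)
    (hgood : W.HasGoodReductionAtPrime p) (hna : ¬ (p : ℤ) ∣ W.frobeniusTrace p - 1) :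
    ∀ P : (W.baseChange ℚ_[p]).toAffine.Point, p • P = 0 → P = 0 :=
  fun P hP ↦ localTorsion_eq_zero_of_good W p hp3
    (not_dvd_minimalDiscriminantInt_of_hasGoodReductionAtPrime' W p hgood)
    (fun h ↦ hna ((dvd_reductionPointCount_iff_dvd_frobeniusTrace_sub_one W p).mp h)) P hP

/-- **`E(ℚ_p)[p] = 0` at a good `p > 5` with `a_p ≠ 1`**: by Hasse (`|a_p| ≤ 2√p < p − 1` for `p ≥ 7`)
`a_p ≡ 1 (mod p) ⟺ a_p = 1` there (tree `CoatesWiles1977.not_dvd_reductionPointCount_of_frobeniusTrace_ne_one`;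
Coates–Wiles' "anomalous" primes, Invent. Math. 39 (1977) p. 231). (At `p = 5` the anomalous classes
are `a_5 ∈ {1, −4}`: use `…_of_not_dvd_frobeniusTrace_sub_one`.)
[cite: SilvermanAEC2009, VII.3 Prop. 3.1 and V.1 Thm. 1.1]
[cite: CoatesWiles1977, §3 p. 231 (Definition)] -/
theorem localTorsion_eq_zero_of_good_of_frobeniusTrace_ne_one (h5 : 5 < p)
    (hgood : W.HasGoodReductionAtPrime p) (hna : W.frobeniusTrace p ≠ 1) :
    ∀ P : (W.baseChange ℚ_[p]).toAffine.Point, p • P = 0 → P = 0 :=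
  have hΔ := not_dvd_minimalDiscriminantInt_of_hasGoodReductionAtPrime' W p hgood
  fun P hP ↦ localTorsion_eq_zero_of_good W p (by omega) hΔ
    (CoatesWiles1977.not_dvd_reductionPointCount_of_frobeniusTrace_ne_one W hp.out h5 hΔ hna) P hP

/-! ### §2 The `(t0)` binder `#E(ℚ_p)[p] = 1` of the Kim twins -/

/-- **`#E(ℚ_p)[p] = 1` at a good `p ≥ 3` with `p ∤ #Ẽ(𝔽_p)`** — the `(t0)` binder
`Nat.card {Q ∈ E(ℚ_p) | p • Q = 0} = 1` of the `…_of_localTorsionTrivial` twins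
(`natCard_localPTorsion_eq_one_iff`). [cite: SilvermanAEC2009, VII.2 Prop. 2.1 and VII.3 Prop. 3.1]
[cite: Kim2022StructureSelmer, Prop. 3.2 (PDF p. 15)] -/
theorem natCard_localPTorsion_eq_one_of_good (hp3 : 3 ≤ p)
    (hΔ : ¬ (p : ℤ) ∣ W.minimalDiscriminantInt) (hN : ¬ p ∣ W.reductionPointCount p) :
    Nat.card {Q : (W.baseChange ℚ_[p]).toAffine.Point // (p : ℕ) • Q = 0} = 1 :=
  (natCard_localPTorsion_eq_one_iff W p).mpr (localTorsion_eq_zero_of_good_int W p hp3 hΔ hN)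

/-- **`#E(ℚ_p)[p] = 1` at a good `p ≥ 3` with `a_p ≢ 1 (mod p)`** (class-theorem currency:
`W.HasGoodReductionAtPrime p`, `¬ p ∣ a_p − 1`).
[cite: SilvermanAEC2009, VII.2 Prop. 2.1 and VII.3 Prop. 3.1]
[cite: Kim2022StructureSelmer, Prop. 3.2 (PDF p. 15)] -/
theorem natCard_localPTorsion_eq_one_of_good_of_not_dvd_frobeniusTrace_sub_one (hp3 : 3 ≤ p)
    (hgood : W.HasGoodReductionAtPrime p) (hna : ¬ (p : ℤ) ∣ W.frobeniusTrace p - 1) :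
    Nat.card {Q : (W.baseChange ℚ_[p]).toAffine.Point // (p : ℕ) • Q = 0} = 1 :=
  (natCard_localPTorsion_eq_one_iff W p).mpr fun P hP ↦
    localTorsion_eq_zero_of_good_of_not_dvd_frobeniusTrace_sub_one W p hp3 hgood hna P
      (by rw [← natCast_zsmul]; exact hP)

/-- **`#E(ℚ_p)[p] = 1` at a good `p > 5` with `a_p ≠ 1`.**
[cite: SilvermanAEC2009, VII.3 Prop. 3.1 and V.1 Thm. 1.1]
[cite: CoatesWiles1977, §3 p. 231 (Definition)] -/
theorem natCard_localPTorsion_eq_one_of_good_of_frobeniusTrace_ne_one (h5 : 5 < p)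
    (hgood : W.HasGoodReductionAtPrime p) (hna : W.frobeniusTrace p ≠ 1) :
    Nat.card {Q : (W.baseChange ℚ_[p]).toAffine.Point // (p : ℕ) • Q = 0} = 1 :=
  (natCard_localPTorsion_eq_one_iff W p).mpr fun P hP ↦
    localTorsion_eq_zero_of_good_of_frobeniusTrace_ne_one W p h5 hgood hna P
      (by rw [← natCast_zsmul]; exact hP)

/-- **`#E(ℚ_p)[p] = 1` at a multiplicative `p ≥ 3` that is non-split or has `p ∤ v_p(Δ_min)`** — the
`(t0)` binder on the automatic multiplicative locus of `LocalTorsionMultiplicativeProofs`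
(`LocalTorsionMult.localTorsion_eq_zero_of_mult_int`; AEC VII.6.1, Ex. 3.5).
[cite: SilvermanAEC2009, VII.3 Prop. 3.1, Thm VII.6.1 and Exercise 3.5] -/
theorem natCard_localPTorsion_eq_one_of_mult (hp3 : 3 ≤ p)
    (hmult : W.HasMultiplicativeReductionAtPrime p)
    (h : ¬ W.HasSplitMultiplicativeReductionAtPrime p ∨
      ¬ p ∣ padicValInt p W.minimalDiscriminantInt) :
    Nat.card {Q : (W.baseChange ℚ_[p]).toAffine.Point // (p : ℕ) • Q = 0} = 1 :=
  (natCard_localPTorsion_eq_one_iff W p).mpr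
    (LocalTorsionMult.localTorsion_eq_zero_of_mult_int W p hp3 hmult h)

end LocalTorsionGood

/-! ### §3 Consumers: the proof-covered Kim twins at a good non-anomalous `p` -/

/-- **B5 twin at a good non-anomalous `p`** — C.-H. Kim, Amer. J. Math. 148, Thm. 1.8 (6) (arXiv
Thm. 1.9 (6)), analytic rank `0`, level-one certificate, in the PROOF-COVERED form
`Kim2022_rankZero_padicValRat_sha_of_kuriharaNumber_ne_zero_of_localTorsionTrivial` (`t = 0`), with its
`(t0)` binder DISCHARGED by `W.HasGoodReductionAtPrime p` and `¬ p ∣ a_p − 1`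
(`natCard_localPTorsion_eq_one_of_good_of_not_dvd_frobeniusTrace_sub_one`). Proved (a reading of the
twin; nothing asserted).
[cite: Kim2022StructureSelmer, Thm. 1.9 (6) (PDF p. 8), Prop. 3.2 (PDF p. 15)]
[cite: SilvermanAEC2009, VII.3 Prop. 3.1] -/
theorem Kim2022_rankZero_padicValRat_sha_of_kuriharaNumber_ne_zero_of_nonAnomalous
    (h : Kim2022_rankZero_padicValRat_sha_of_kuriharaNumber_ne_zero_of_localTorsionTrivial) :
    ∀ (W : WeierstrassCurve ℚ) [W.IsElliptic] [W.IsGloballyMinimal] (p : ℕ) [Fact p.Prime],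
    5 ≤ p → W.HasGoodReductionAtPrime p → ¬ (p : ℤ) ∣ W.frobeniusTrace p - 1 →
    W.HasSurjectiveModNGaloisRep p →
    W.entireLFunction 1 ≠ 0 → Finite W.sha →
    ∀ {N : ℕ} [NeZero N] (f : CuspForm (Gamma0 N) 2), IsNewformOf W f →
    (∃ u : ℚ, ‖(u : ℚ_[p])‖ = 1 ∧ W.realPeriodRat = u * plusPeriod f) →
    ∀ (n : ℕ) [NeZero n], Kato.IsKolyvaginProduct W p 1 n →
    (∀ (ℓ : ℕ) [Fact ℓ.Prime], ℓ ∣ n →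
      Nat.card {P : ((WeierstrassCurve.integralModelInt W).map
          (Int.castRingHom (ZMod ℓ))).toAffine.Point // p • P = 0} ≤ p) →
    ∀ ψ : (ℓ : ℕ) → (ZMod ℓ)ˣ →* Multiplicative (ZMod (p ^ 1)),
      (∀ ℓ ∈ n.primeFactors, Function.Surjective (ψ ℓ)) →
      kuriharaNumber f (p ^ 1) n ψ ≠ 0 →
    ∃ q : ℚ, W.entireLFunction 1 / (W.realPeriodRat : ℂ) = (q : ℂ) ∧
      padicValRat p q = (padicValNat p (Nat.card (AddCommGroup.primaryComponent W.sha p)) : ℤ) :=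
  fun W _ _ p _ hp hgood hna hsurj hL hfin _ _ f hf hu n _ hn hcyc ψ hψ hδ ↦
    h W p hp (Or.inl hgood) hsurj
      (natCard_localPTorsion_eq_one_of_good_of_not_dvd_frobeniusTrace_sub_one W p (by omega)
        hgood hna)
      hL hfin f hf hu n hn hcyc ψ hψ hδ

/-- **B5 twin at a multiplicative `p` on the automatic locus** (non-split, or `p ∤ v_p(Δ_min)`;
`natCard_localPTorsion_eq_one_of_mult`). Proved.
[cite: Kim2022StructureSelmer, Thm. 1.9 (6) (PDF p. 8), Prop. 3.2 (PDF p. 15)]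
[cite: SilvermanAEC2009, Thm VII.6.1 and Exercise 3.5] -/
theorem Kim2022_rankZero_padicValRat_sha_of_kuriharaNumber_ne_zero_of_mult_auto
    (h : Kim2022_rankZero_padicValRat_sha_of_kuriharaNumber_ne_zero_of_localTorsionTrivial) :
    ∀ (W : WeierstrassCurve ℚ) [W.IsElliptic] [W.IsGloballyMinimal] (p : ℕ) [Fact p.Prime],
    5 ≤ p → W.HasMultiplicativeReductionAtPrime p →
    (¬ W.HasSplitMultiplicativeReductionAtPrime p ∨ ¬ p ∣ padicValInt p W.minimalDiscriminantInt) →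
    W.HasSurjectiveModNGaloisRep p →
    W.entireLFunction 1 ≠ 0 → Finite W.sha →
    ∀ {N : ℕ} [NeZero N] (f : CuspForm (Gamma0 N) 2), IsNewformOf W f →
    (∃ u : ℚ, ‖(u : ℚ_[p])‖ = 1 ∧ W.realPeriodRat = u * plusPeriod f) →
    ∀ (n : ℕ) [NeZero n], Kato.IsKolyvaginProduct W p 1 n →
    (∀ (ℓ : ℕ) [Fact ℓ.Prime], ℓ ∣ n →
      Nat.card {P : ((WeierstrassCurve.integralModelInt W).map
          (Int.castRingHom (ZMod ℓ))).toAffine.Point // p • P = 0} ≤ p) →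
    ∀ ψ : (ℓ : ℕ) → (ZMod ℓ)ˣ →* Multiplicative (ZMod (p ^ 1)),
      (∀ ℓ ∈ n.primeFactors, Function.Surjective (ψ ℓ)) →
      kuriharaNumber f (p ^ 1) n ψ ≠ 0 →
    ∃ q : ℚ, W.entireLFunction 1 / (W.realPeriodRat : ℂ) = (q : ℂ) ∧
      padicValRat p q = (padicValNat p (Nat.card (AddCommGroup.primaryComponent W.sha p)) : ℤ) :=
  fun W _ _ p _ hp hmult hauto hsurj hL hfin _ _ f hf hu n _ hn hcyc ψ hψ hδ ↦
    h W p hp (Or.inr hmult) hsurj (natCard_localPTorsion_eq_one_of_mult W p (by omega) hmult hauto)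
      hL hfin f hf hu n hn hcyc ψ hψ hδ

/-- **B6 twin at a good non-anomalous `p`** — Thm. 1.8 (6), analytic rank `1`, level-one certificate at a
prime level, proof-covered form `Kim2022_rankOne_card_sha_eq_one_of_kuriharaNumber_ne_zero_of_localTorsionTrivial`
with the `(t0)` binder discharged by good reduction and `¬ p ∣ a_p − 1`. Proved.
[cite: Kim2022StructureSelmer, Thm. 1.9 (6) (PDF p. 8), Prop. 3.2 (PDF p. 15)]
[cite: SilvermanAEC2009, VII.3 Prop. 3.1] -/
theorem Kim2022_rankOne_card_sha_eq_one_of_kuriharaNumber_ne_zero_of_nonAnomalous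
    (h : Kim2022_rankOne_card_sha_eq_one_of_kuriharaNumber_ne_zero_of_localTorsionTrivial) :
    ∀ (W : WeierstrassCurve ℚ) [W.IsElliptic] [W.IsGloballyMinimal] (p : ℕ) [Fact p.Prime],
    5 ≤ p → W.HasGoodReductionAtPrime p → ¬ (p : ℤ) ∣ W.frobeniusTrace p - 1 →
    W.HasSurjectiveModNGaloisRep p →
    W.entireLFunction 1 = 0 → W.analyticRank = 1 → Finite W.sha →
    ∀ {N : ℕ} [NeZero N] (f : CuspForm (Gamma0 N) 2), IsNewformOf W f →
    (∃ u : ℚ, ‖(u : ℚ_[p])‖ = 1 ∧ W.realPeriodRat = u * plusPeriod f) →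
    ∀ (ℓ : ℕ) [Fact ℓ.Prime], Kato.IsKolyvaginPrime W p 1 ℓ →
    Nat.card {P : ((WeierstrassCurve.integralModelInt W).map
        (Int.castRingHom (ZMod ℓ))).toAffine.Point // p • P = 0} ≤ p →
    ∀ ψ : (ℓ' : ℕ) → (ZMod ℓ')ˣ →* Multiplicative (ZMod (p ^ 1)),
      Function.Surjective (ψ ℓ) →
      kuriharaNumber f (p ^ 1) ℓ ψ ≠ 0 →
    Nat.card (AddCommGroup.primaryComponent W.sha p) = 1 :=
  fun W _ _ p _ hp hgood hna hsurj hL hr hfin _ _ f hf hu ℓ _ hℓ hcyc ψ hψ hδ ↦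
    h W p hp (Or.inl hgood) hsurj
      (natCard_localPTorsion_eq_one_of_good_of_not_dvd_frobeniusTrace_sub_one W p (by omega)
        hgood hna)
      hL hr hfin f hf hu ℓ hℓ hcyc ψ hψ hδ

/-- **B6 twin at a multiplicative `p` on the automatic locus** (non-split, or `p ∤ v_p(Δ_min)`). Proved.
[cite: Kim2022StructureSelmer, Thm. 1.9 (6) (PDF p. 8), Prop. 3.2 (PDF p. 15)]
[cite: SilvermanAEC2009, Thm VII.6.1 and Exercise 3.5] -/
theorem Kim2022_rankOne_card_sha_eq_one_of_kuriharaNumber_ne_zero_of_mult_auto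
    (h : Kim2022_rankOne_card_sha_eq_one_of_kuriharaNumber_ne_zero_of_localTorsionTrivial) :
    ∀ (W : WeierstrassCurve ℚ) [W.IsElliptic] [W.IsGloballyMinimal] (p : ℕ) [Fact p.Prime],
    5 ≤ p → W.HasMultiplicativeReductionAtPrime p →
    (¬ W.HasSplitMultiplicativeReductionAtPrime p ∨ ¬ p ∣ padicValInt p W.minimalDiscriminantInt) →
    W.HasSurjectiveModNGaloisRep p →
    W.entireLFunction 1 = 0 → W.analyticRank = 1 → Finite W.sha →
    ∀ {N : ℕ} [NeZero N] (f : CuspForm (Gamma0 N) 2), IsNewformOf W f →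
    (∃ u : ℚ, ‖(u : ℚ_[p])‖ = 1 ∧ W.realPeriodRat = u * plusPeriod f) →
    ∀ (ℓ : ℕ) [Fact ℓ.Prime], Kato.IsKolyvaginPrime W p 1 ℓ →
    Nat.card {P : ((WeierstrassCurve.integralModelInt W).map
        (Int.castRingHom (ZMod ℓ))).toAffine.Point // p • P = 0} ≤ p →
    ∀ ψ : (ℓ' : ℕ) → (ZMod ℓ')ˣ →* Multiplicative (ZMod (p ^ 1)),
      Function.Surjective (ψ ℓ) →
      kuriharaNumber f (p ^ 1) ℓ ψ ≠ 0 →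
    Nat.card (AddCommGroup.primaryComponent W.sha p) = 1 :=
  fun W _ _ p _ hp hmult hauto hsurj hL hr hfin _ _ f hf hu ℓ _ hℓ hcyc ψ hψ hδ ↦
    h W p hp (Or.inr hmult) hsurj (natCard_localPTorsion_eq_one_of_mult W p (by omega) hmult hauto)
      hL hr hfin f hf hu ℓ hℓ hcyc ψ hψ hδ

/-- **B7 twin at a good non-anomalous `p`** — Thm. 1.8 (6), analytic rank `0`, level-one certificate,
Manin datum (any reduction type in the fact; here `p` GOOD), proof-covered form
`Kim2022_rankZero_padicValRat_sha_of_kuriharaNumber_ne_zero_of_maninConstant_of_localTorsionTrivial` with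
the `(t0)` binder discharged by `W.HasGoodReductionAtPrime p` and `¬ p ∣ a_p − 1`. Proved.
[cite: Kim2022StructureSelmer, Thm. 1.9 (6) (PDF p. 8), Prop. 3.2 (PDF p. 15)]
[cite: SilvermanAEC2009, VII.3 Prop. 3.1] -/
theorem Kim2022_rankZero_padicValRat_sha_of_kuriharaNumber_ne_zero_of_maninConstant_of_nonAnomalous
    (h : Kim2022_rankZero_padicValRat_sha_of_kuriharaNumber_ne_zero_of_maninConstant_of_localTorsionTrivial) :
    ∀ (W : WeierstrassCurve ℚ) [W.IsElliptic] [W.IsGloballyMinimal] (p : ℕ) [Fact p.Prime],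
    5 ≤ p → W.HasGoodReductionAtPrime p → ¬ (p : ℤ) ∣ W.frobeniusTrace p - 1 →
    W.HasSurjectiveModNGaloisRep p →
    W.entireLFunction 1 ≠ 0 → Finite W.sha →
    ∀ {N : ℕ} [NeZero N] (D : ModularParametrizationData W N),
    ¬ (p : ℤ) ∣ D.maninConstant →
    (∃ u : ℚ, ‖(u : ℚ_[p])‖ = 1 ∧ W.realPeriodRat = u * plusPeriod D.f) →
    ∀ (n : ℕ) [NeZero n], Kato.IsKolyvaginProduct W p 1 n →
    (∀ (ℓ : ℕ) [Fact ℓ.Prime], ℓ ∣ n →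
      Nat.card {P : ((WeierstrassCurve.integralModelInt W).map
          (Int.castRingHom (ZMod ℓ))).toAffine.Point // p • P = 0} ≤ p) →
    ∀ ψ : (ℓ : ℕ) → (ZMod ℓ)ˣ →* Multiplicative (ZMod (p ^ 1)),
      (∀ ℓ ∈ n.primeFactors, Function.Surjective (ψ ℓ)) →
      kuriharaNumber D.f (p ^ 1) n ψ ≠ 0 →
    ∃ q : ℚ, W.entireLFunction 1 / (W.realPeriodRat : ℂ) = (q : ℂ) ∧
      padicValRat p q = (padicValNat p (Nat.card (AddCommGroup.primaryComponent W.sha p)) : ℤ) :=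
  fun W _ _ p _ hp hgood hna hsurj hL hfin _ _ D hc hu n _ hn hcyc ψ hψ hδ ↦
    h W p hp hsurj
      (natCard_localPTorsion_eq_one_of_good_of_not_dvd_frobeniusTrace_sub_one W p (by omega)
        hgood hna)
      hL hfin D hc hu n hn hcyc ψ hψ hδ

/-- **B8 twin at a good non-anomalous `p`** — Thm. 1.8 (1), (4), (6), analytic rank `1`, level-one
certificate at a prime level, Manin datum (here `p` GOOD), proof-covered form
`Kim2022_rankOne_card_sha_eq_one_of_kuriharaNumber_ne_zero_of_maninConstant_of_localTorsionTrivial` with the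
`(t0)` binder discharged by `W.HasGoodReductionAtPrime p` and `¬ p ∣ a_p − 1`. Proved.
[cite: Kim2022StructureSelmer, Thm. 1.9 (6) (PDF p. 8), Prop. 3.2 (PDF p. 15)]
[cite: SilvermanAEC2009, VII.3 Prop. 3.1] -/
theorem Kim2022_rankOne_card_sha_eq_one_of_kuriharaNumber_ne_zero_of_maninConstant_of_nonAnomalous
    (h : Kim2022_rankOne_card_sha_eq_one_of_kuriharaNumber_ne_zero_of_maninConstant_of_localTorsionTrivial) :
    ∀ (W : WeierstrassCurve ℚ) [W.IsElliptic] [W.IsGloballyMinimal] (p : ℕ) [Fact p.Prime],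
    5 ≤ p → W.HasGoodReductionAtPrime p → ¬ (p : ℤ) ∣ W.frobeniusTrace p - 1 →
    W.HasSurjectiveModNGaloisRep p →
    W.entireLFunction 1 = 0 → W.analyticRank = 1 → Finite W.sha →
    ∀ {N : ℕ} [NeZero N] (D : ModularParametrizationData W N),
    ¬ (p : ℤ) ∣ D.maninConstant →
    (∃ u : ℚ, ‖(u : ℚ_[p])‖ = 1 ∧ W.realPeriodRat = u * plusPeriod D.f) →
    ∀ (ℓ : ℕ) [Fact ℓ.Prime], Kato.IsKolyvaginPrime W p 1 ℓ →
    Nat.card {P : ((WeierstrassCurve.integralModelInt W).map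
        (Int.castRingHom (ZMod ℓ))).toAffine.Point // p • P = 0} ≤ p →
    ∀ ψ : (ℓ' : ℕ) → (ZMod ℓ')ˣ →* Multiplicative (ZMod (p ^ 1)),
      Function.Surjective (ψ ℓ) →
      kuriharaNumber D.f (p ^ 1) ℓ ψ ≠ 0 →
    Nat.card (AddCommGroup.primaryComponent W.sha p) = 1 :=
  fun W _ _ p _ hp hgood hna hsurj hL hr hfin _ _ D hc hu ℓ _ hℓ hcyc ψ hψ hδ ↦
    h W p hp hsurj
      (natCard_localPTorsion_eq_one_of_good_of_not_dvd_frobeniusTrace_sub_one W p (by omega)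
        hgood hna)
      hL hr hfin D hc hu ℓ hℓ hcyc ψ hψ hδ

namespace Kim2026

/-- **B12 twin at a good non-anomalous `p`** — Kim 2026, Thm. 1.8 (6), analytic rank `0`, a certificate
`δ̃_n^{(k)} ≠ 0` at depth `k`, LOWER bound `ord_p(L(E,1)/Ω) ≤ ord_p #Ш(p) + (k − 1)`, proof-covered form
`Kim2026.rankZero_le_padicValNat_sha_of_kuriharaNumber_ne_zero_of_localTorsionTrivial` with the `(t0)`
binder discharged by `W.HasGoodReductionAtPrime p` and `¬ p ∣ a_p − 1`. Proved.
[cite: Kim2022StructureSelmer, Thm. 1.9 (6) (PDF p. 8), Prop. 3.2 (PDF p. 15)]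
[cite: SilvermanAEC2009, VII.3 Prop. 3.1] -/
theorem rankZero_le_padicValNat_sha_of_kuriharaNumber_ne_zero_of_nonAnomalous
    (h : rankZero_le_padicValNat_sha_of_kuriharaNumber_ne_zero_of_localTorsionTrivial) :
    ∀ (W : WeierstrassCurve ℚ) [W.IsElliptic] [W.IsGloballyMinimal] (p : ℕ) [Fact p.Prime],
    5 ≤ p → W.HasGoodReductionAtPrime p → ¬ (p : ℤ) ∣ W.frobeniusTrace p - 1 →
    W.HasSurjectiveModNGaloisRep p →
    W.entireLFunction 1 ≠ 0 → Finite W.sha →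
    ∀ {N : ℕ} [NeZero N] (D : ModularParametrizationData W N),
    ¬ (p : ℤ) ∣ D.maninConstant →
    (∃ u : ℚ, ‖(u : ℚ_[p])‖ = 1 ∧ W.realPeriodRat = u * plusPeriod D.f) →
    ∀ (k n : ℕ) [NeZero n], 1 ≤ k → Kato.IsKolyvaginProduct W p k n →
    (∀ (ℓ : ℕ) [Fact ℓ.Prime], ℓ ∣ n →
      Nat.card {P : ((WeierstrassCurve.integralModelInt W).map
          (Int.castRingHom (ZMod ℓ))).toAffine.Point // p • P = 0} ≤ p) →
    ∀ ψ : (ℓ : ℕ) → (ZMod ℓ)ˣ →* Multiplicative (ZMod (p ^ k)),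
      (∀ ℓ ∈ n.primeFactors, Function.Surjective (ψ ℓ)) →
      kuriharaNumber D.f (p ^ k) n ψ ≠ 0 →
    ∃ q : ℚ, W.entireLFunction 1 / (W.realPeriodRat : ℂ) = (q : ℂ) ∧
      padicValRat p q ≤
        (padicValNat p (Nat.card (AddCommGroup.primaryComponent W.sha p)) : ℤ) + ((k - 1 : ℕ) : ℤ) :=
  fun W _ _ p _ hp hgood hna hsurj hL hfin _ _ D hc hu k n _ hk hn hcyc ψ hψ hδ ↦
    h W p hp hsurj
      (natCard_localPTorsion_eq_one_of_good_of_not_dvd_frobeniusTrace_sub_one W p (by omega)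
        hgood hna)
      hL hfin D hc hu k n hk hn hcyc ψ hψ hδ

end Kim2026

end Literature.NumberTheory.EllipticCurves

end
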